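import Summits.CriticalPhenomena.PercolationContinuityZ3.Theorems.Transplant.FKConnectivityAllQForestNearTightEarsMain
import HarnessLib

/-!
# Near-tight gadgets with PINNED inside pairs: the dichotomy and the type-II ear lemma

Support file (`--supports stmt-CriticalPhenomena-4575`), FK sub-lane `prim-bschramm-fk-1` (gen 22) of the post-continuity programme;
builds on p205010 (kernel theorem, internal audit signed; external expert review pending).  No definitions, no named facts, no sorries;
standard axioms.  Part 1 of 3 of the PINNED EARS THEOREM (`…NearTightPinnedEarsValid`, `…NearTightPinnedEarsMain`).

The ears theorem `adjForestNoSq_fibre_of_ears` (`…NearTightEarsMain`) asks all inside pairs `E` to be FREE (`E ⊆ M`).  On a general fibre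
`(M, u₀)` the gadget may contain PINNED pairs (`∈ u₀`, present in both classes — the doubled pairs of the multigraph); counted twice they
keep the near-tight count: **`2|U| ≤ |E ∩ M| + 2|E ∩ u₀| + 3`**.  Only the four pairs `e, f, r, t` of the two ears must be free.
* `card_filter_mem_add_card_filter_symmDiff`, **`card_image_add_card_image_of_fibre`** — `m₁ + m₂ + |E ∩ M| + 2|E ∩ u₀| = 2|U|`;
* **`nearTight_dichotomy_of_fibre`** — the (spanning, at-most-two-components) dichotomy under the pinned count;
* **`ears_typeII_pinned`** — verbatim `ears_typeII` with `E ⊆ M` weakened to `e, f, r, t ∈ M`.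
[cite: Grimmett2006, §1.5 (p. 13)] [cite: Linusson2011, Prop. 2.6] [cite: SempleWelsh2008, Conj. 1.1 (p. 2)]
-/

noncomputable section

namespace Summit.CriticalPhenomena.PercolationContinuityZ3.Theorems
namespace FK

open Set Literature.Probability.LatticeModels Literature.Probability.Percolation
open scoped Classical symmDiff

variable {V : Type*} [Fintype V]

/-! ### The pinned near-tight count -/

section PinnedCount

variable {M u₀ ω : BondConfig V} {U : Finset V} {E : Finset (Sym2 V)}

omit [Fintype V] in
/-- On the fibre `(M, u₀)` with `E ⊆ M ∪ u₀`: `#{g ∈ E | g ∈ ω} + #{g ∈ E | g ∈ ω ∆ M} = #{g ∈ E | g ∈ M} + 2 #{g ∈ E | g ∈ u₀}`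
(a free pair lies in exactly one class, a pinned pair in both). [cite: Linusson2011, Prop. 2.6] -/
theorem card_filter_mem_add_card_filter_symmDiff (hd : Disjoint u₀ M) (hω : ω \ M = u₀) (hEMu : ∀ g ∈ E, g ∈ M ∨ g ∈ u₀) :
    (E.filter fun g => g ∈ ω).card + (E.filter fun g => g ∈ ω ∆ M).card =
      (E.filter fun g => g ∈ M).card + 2 * (E.filter fun g => g ∈ u₀).card := by
  have hu : u₀ ⊆ ω := subset_of_fibre hω
  have hdis : ∀ {g}, g ∈ u₀ → g ∉ M := fun hg hgM => Set.disjoint_left.1 hd hg hgM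
  rw [Finset.card_filter, Finset.card_filter, Finset.card_filter, Finset.card_filter, Finset.mul_sum, ← Finset.sum_add_distrib,
    ← Finset.sum_add_distrib]
  refine Finset.sum_congr rfl fun g hg => ?_
  rcases hEMu g hg with hgM | hgu
  · have hgu : g ∉ u₀ := fun h => hdis h hgM
    by_cases hgω : g ∈ ω
    · have : g ∉ ω ∆ M := fun h => ((mem_symmDiff_iff_not_mem hgM).1 h) hgω
      simp [hgω, this, hgM, hgu]
    · have : g ∈ ω ∆ M := (mem_symmDiff_iff_not_mem hgM).2 hgω
      simp [hgω, this, hgM, hgu]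
  · have hgω : g ∈ ω := hu hgu
    have hgB : g ∈ ω ∆ M := Set.mem_symmDiff.2 (Or.inl ⟨hgω, hdis hgu⟩)
    simp [hgω, hgB, hdis hgu, hgu]

/-- **THE PINNED NEAR-TIGHT COUNT**: for `E ⊆ M ∪ u₀` inside `U` and a fibre pair `(ω, ω ∆ M)` of forests on `(M, u₀)`,
`#{classes of ω ∩ E met by U} + #{classes of (ω ∆ M) ∩ E met by U} + |E ∩ M| + 2|E ∩ u₀| = 2|U|`.
[cite: Grimmett2006, §1.5 (p. 13)] [cite: Linusson2011, Prop. 2.6] -/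
theorem card_image_add_card_image_of_fibre (hd : Disjoint u₀ M) (hω : ω \ M = u₀) (hEMu : ∀ g ∈ E, g ∈ M ∨ g ∈ u₀)
    (hEU : ∀ g ∈ E, ∀ w ∈ g, w ∈ U) (hA : IsForestCfg ω) (hB : IsForestCfg (ω ∆ M)) :
    (U.image (openGraph (ω ∩ ↑E)).connectedComponentMk).card + (U.image (openGraph ((ω ∆ M) ∩ ↑E)).connectedComponentMk).card +
      ((E.filter fun g => g ∈ M).card + 2 * (E.filter fun g => g ∈ u₀).card) = 2 * U.card := by
  have h1 := ncard_add_card_image_eq (U := U) (isForestCfg_of_subset hA (inter_subset_left (t := (↑E : Set (Sym2 V)))))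
    fun g hg w hw => hEU g hg.2 w hw
  have h2 := ncard_add_card_image_eq (U := U) (isForestCfg_of_subset hB (inter_subset_left (t := (↑E : Set (Sym2 V)))))
    fun g hg w hw => hEU g hg.2 w hw
  have n1 : (ω ∩ (↑E : Set (Sym2 V))).ncard = (E.filter fun g => g ∈ ω).card := by
    rw [inter_coe_eq_filter, Set.ncard_coe_finset]
  have n2 : ((ω ∆ M) ∩ (↑E : Set (Sym2 V))).ncard = (E.filter fun g => g ∈ ω ∆ M).card := by
    rw [inter_coe_eq_filter, Set.ncard_coe_finset]
  have n3 := card_filter_mem_add_card_filter_symmDiff (E := E) hd hω hEMu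
  omega

/-- **THE DICHOTOMY with pinned inside pairs**: if `E ⊆ M ∪ u₀` lies inside `U` and `2|U| ≤ |E ∩ M| + 2|E ∩ u₀| + 3`, then for every
fibre pair of forests one inside class joins `U` pairwise and the other joins two of any three vertices of `U`.
[cite: Grimmett2006, §1.5 (p. 13)] [cite: Linusson2011, Prop. 2.6] -/
theorem nearTight_dichotomy_of_fibre (hd : Disjoint u₀ M) (hω : ω \ M = u₀) (hEMu : ∀ g ∈ E, g ∈ M ∨ g ∈ u₀)
    (hEU : ∀ g ∈ E, ∀ w ∈ g, w ∈ U) (hcard : 2 * U.card ≤ (E.filter fun g => g ∈ M).card + 2 * (E.filter fun g => g ∈ u₀).card + 3)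
    (hA : IsForestCfg ω) (hB : IsForestCfg (ω ∆ M)) :
    ((∀ p ∈ U, ∀ q ∈ U, (openGraph (ω ∩ ↑E)).Reachable p q) ∧
      (∀ p ∈ U, ∀ q ∈ U, ∀ w ∈ U, (openGraph ((ω ∆ M) ∩ ↑E)).Reachable p q ∨
        (openGraph ((ω ∆ M) ∩ ↑E)).Reachable p w ∨ (openGraph ((ω ∆ M) ∩ ↑E)).Reachable q w)) ∨
    ((∀ p ∈ U, ∀ q ∈ U, (openGraph ((ω ∆ M) ∩ ↑E)).Reachable p q) ∧
      (∀ p ∈ U, ∀ q ∈ U, ∀ w ∈ U, (openGraph (ω ∩ ↑E)).Reachable p q ∨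
        (openGraph (ω ∩ ↑E)).Reachable p w ∨ (openGraph (ω ∩ ↑E)).Reachable q w)) := by
  have hsum := card_image_add_card_image_of_fibre (U := U) hd hω hEMu hEU hA hB
  by_cases hU : U = ∅
  · subst hU
    exact Or.inl ⟨fun p hp => absurd hp (Finset.notMem_empty p), fun p hp => absurd hp (Finset.notMem_empty p)⟩
  obtain ⟨u, hu⟩ := Finset.nonempty_iff_ne_empty.2 hU
  have m1 : 1 ≤ (U.image (openGraph (ω ∩ ↑E)).connectedComponentMk).card :=
    Finset.card_pos.2 ⟨_, Finset.mem_image_of_mem _ hu⟩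
  have m2 : 1 ≤ (U.image (openGraph ((ω ∆ M) ∩ ↑E)).connectedComponentMk).card :=
    Finset.card_pos.2 ⟨_, Finset.mem_image_of_mem _ hu⟩
  by_cases h1 : (U.image (openGraph (ω ∩ ↑E)).connectedComponentMk).card ≤ 1
  · refine Or.inl ⟨fun p hp q hq => reachable_of_card_image_le_one h1 hp hq, fun p hp q hq w hw => ?_⟩
    exact reachable_or_of_card_image_le_two (by omega) hp hq hw
  · refine Or.inr ⟨fun p hp q hq => reachable_of_card_image_le_one (by omega) hp hq, fun p hp q hq w hw => ?_⟩
    exact reachable_or_of_card_image_le_two (by omega) hp hq hw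

end PinnedCount

/-! ### The type-II ear lemma with pinned inside pairs -/

section PinnedEars

variable {M u₀ : BondConfig V} {U : Finset V} {E : Finset (Sym2 V)} {o v v' y' y : V}

variable (hd : Disjoint u₀ M) (hEMu : ∀ g ∈ E, g ∈ M ∨ g ∈ u₀) (hEU : ∀ g ∈ E, ∀ w ∈ g, w ∈ U)
  (hcard : 2 * U.card ≤ (E.filter fun g => g ∈ M).card + 2 * (E.filter fun g => g ∈ u₀).card + 3)
  (heE : s(o, v) ∈ E) (hfE : s(o, y) ∈ E) (hrE : s(v, v') ∈ E) (htE : s(y', y) ∈ E)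
  (hve : ∀ g ∈ E, v ∈ g → g = s(o, v) ∨ g = s(v, v')) (hye : ∀ g ∈ E, y ∈ g → g = s(o, y) ∨ g = s(y', y))
  (hov : o ≠ v) (hoy : o ≠ y) (hvy : v ≠ y) (hvv' : v ≠ v') (hyy' : y ≠ y') (hv'y : v' ≠ y) (hvy' : v ≠ y')
include hd hEMu hEU hcard heE hfE hrE htE hve hye hov hoy hvy hvv' hyy' hv'y hvy'

omit [Fintype V] hd hEMu hcard in
/-- **Type II** (`B ∩ E` joins `U` pairwise, `A ∩ E` joins two of any three): `r, t ∈ B`; `o ↮ v` in `B − r`; `o ↮ y` in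
`B − t`; and `v ~ v'` in `A − e` excludes `y' ~ y` in `A − f`.  Here `(A, B) = (ω, ω ∆ M)` is a bad pair of forests
(`e, f ∈ A`). [cite: Grimmett2006, §1.5 (p. 13)] [cite: Linusson2011, Prop. 2.6] -/
theorem ears_typeII_pinned {ω : BondConfig V} (heM : s(o, v) ∈ M) (hfM : s(o, y) ∈ M) (hrM : s(v, v') ∈ M)
    (htM : s(y', y) ∈ M) (hA : IsForestCfg ω) (hB : IsForestCfg (ω ∆ M)) (he : s(o, v) ∈ ω) (hf : s(o, y) ∈ ω)
    (hconn : ∀ p ∈ U, ∀ q ∈ U, (openGraph ((ω ∆ M) ∩ ↑E)).Reachable p q)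
    (hthree : ∀ p ∈ U, ∀ q ∈ U, ∀ w ∈ U, (openGraph (ω ∩ ↑E)).Reachable p q ∨ (openGraph (ω ∩ ↑E)).Reachable p w ∨
      (openGraph (ω ∩ ↑E)).Reachable q w) :
    s(v, v') ∉ ω ∧ s(y', y) ∉ ω ∧ ¬ (openGraph ((ω ∆ M) \ {s(v, v')})).Reachable o v ∧
      ¬ (openGraph ((ω ∆ M) \ {s(y', y)})).Reachable o y ∧
      ((openGraph (ω \ {s(o, v)})).Reachable v v' → ¬ (openGraph (ω \ {s(o, y)})).Reachable y' y) := by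
  obtain ⟨hoU, hvU, hv'U, hy'U, hyU⟩ := ears_mem_U hEU heE hfE hrE htE
  have hxB : ∀ {g : Sym2 V}, g ∈ M → (g ∈ ω ∆ M ↔ g ∉ ω) := fun hg => mem_symmDiff_iff_not_mem hg
  have heB : s(o, v) ∉ ω ∆ M := fun h => (hxB heM).1 h he
  have hfB : s(o, y) ∉ ω ∆ M := fun h => (hxB hfM).1 h hf
  -- `r, t ∈ B`: the spanning class has a pair at each ear, and it is not `e` / `f`
  have hr : s(v, v') ∉ ω := by
    obtain ⟨g, hg, hvg⟩ := exists_mem_of_reachable (hconn v hvU o hoU) hov.symm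
    rcases hve g hg.2 hvg with rfl | rfl
    · exact absurd hg.1 heB
    · exact (hxB hrM).1 hg.1
  have ht : s(y', y) ∉ ω := by
    obtain ⟨g, hg, hyg⟩ := exists_mem_of_reachable (hconn y hyU o hoU) hoy.symm
    rcases hye g hg.2 hyg with rfl | rfl
    · exact absurd hg.1 hfB
    · exact (hxB htM).1 hg.1
  have hrB : s(v, v') ∈ ω ∆ M := (hxB hrM).2 hr
  have htB : s(y', y) ∈ ω ∆ M := (hxB htM).2 ht
  have htB' : s(y, y') ∈ ω ∆ M := by rw [Sym2.eq_swap]; exact htB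
  -- the ears are leaves of `B ∩ E`
  have hleafv : ∀ g ∈ (ω ∆ M) ∩ (↑E : Set (Sym2 V)), v ∈ g → g = s(v, v') := fun g hg hvg => by
    rcases hve g hg.2 hvg with rfl | h
    · exact absurd hg.1 heB
    · exact h
  have hleafy : ∀ g ∈ (ω ∆ M) ∩ (↑E : Set (Sym2 V)), y ∈ g → g = s(y, y') := fun g hg hyg => by
    rcases hye g hg.2 hyg with rfl | h
    · exact absurd hg.1 hfB
    · rw [h, Sym2.eq_swap]
  have hU3 : ¬ (openGraph ((ω ∆ M) \ {s(v, v')})).Reachable o v :=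
    not_reachable_of_conn_leaf hB hconn hv'U hoU hvv' hov.symm hleafv hrB
  have hU4 : ¬ (openGraph ((ω ∆ M) \ {s(y', y)})).Reachable o y := by
    have h := not_reachable_of_conn_leaf hB hconn hy'U hoU hyy' hoy.symm hleafy htB'
    rwa [Sym2.eq_swap (a := y) (b := y')] at h
  refine ⟨hr, ht, hU3, hU4, fun hvv hyy => ?_⟩
  -- the ears are leaves of `F = A ∩ E` hanging at `o`
  have hleafvA : ∀ g ∈ ω ∩ (↑E : Set (Sym2 V)), v ∈ g → g = s(v, o) := fun g hg hvg => by
    rcases hve g hg.2 hvg with h | rfl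
    · rw [h, Sym2.eq_swap]
    · exact absurd hg.1 hr
  have hleafyA : ∀ g ∈ ω ∩ (↑E : Set (Sym2 V)), y ∈ g → g = s(y, o) := fun g hg hyg => by
    rcases hye g hg.2 hyg with h | rfl
    · rw [h, Sym2.eq_swap]
    · exact absurd hg.1 ht
  have heA : ¬ (openGraph (ω \ {s(o, v)})).Reachable o v := by
    have hback : insert s(o, v) (ω \ {s(o, v)}) = ω := by rw [insert_sdiff_singleton, insert_eq_of_mem he]
    have hA' : IsForestCfg (insert s(o, v) (ω \ {s(o, v)})) := by rwa [hback]
    exact ((isForestCfg_insert_iff hov fun h' => h'.2 rfl).1 hA').2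
  have hfA : ¬ (openGraph (ω \ {s(o, y)})).Reachable o y := by
    have hback : insert s(o, y) (ω \ {s(o, y)}) = ω := by rw [insert_sdiff_singleton, insert_eq_of_mem hf]
    have hA' : IsForestCfg (insert s(o, y) (ω \ {s(o, y)})) := by rwa [hback]
    exact ((isForestCfg_insert_iff hoy fun h' => h'.2 rfl).1 hA').2
  -- (a) `v' ↮ o` in `F`: else off the leaf pair `e`, and then `v ~ v' ~ o` in `A − e`
  have ha : ¬ (openGraph (ω ∩ ↑E)).Reachable v' o := fun h => by
    have h1 := reachable_sdiff_of_leaf hleafvA hvv' hov.symm h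
    rw [Sym2.eq_swap (a := v) (b := o)] at h1
    exact heA ((hvv.trans (h1.mono (openGraph_mono (sdiff_subset_sdiff_left inter_subset_left)))).symm)
  -- (b) `y' ↮ o` in `F`
  have hb : ¬ (openGraph (ω ∩ ↑E)).Reachable y' o := fun h => by
    have h1 := reachable_sdiff_of_leaf hleafyA hyy' hoy.symm h
    rw [Sym2.eq_swap (a := y) (b := o)] at h1
    exact hfA ((hyy.symm.trans (h1.mono (openGraph_mono (sdiff_subset_sdiff_left inter_subset_left)))).symm)
  -- (c) hence `v' ~ y'` in `F`, and off both leaf pairs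
  have hc : (openGraph (ω ∩ ↑E)).Reachable v' y' := by
    rcases hthree v' hv'U y' hy'U o hoU with h | h | h
    · exact h
    · exact absurd h ha
    · exact absurd h hb
  have hd : (openGraph (((ω ∩ ↑E) \ {s(o, v)}) \ {s(o, y)})).Reachable v' y' := by
    have h1 := reachable_sdiff_of_leaf hleafvA hvv' hvy' hc
    rw [Sym2.eq_swap (a := v) (b := o)] at h1
    have hleafyA' : ∀ g ∈ (ω ∩ (↑E : Set (Sym2 V))) \ {s(o, v)}, y ∈ g → g = s(y, o) := fun g hg hyg => hleafyA g hg.1 hyg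
    have h2 := reachable_sdiff_of_leaf hleafyA' hv'y.symm hyy' h1
    rwa [Sym2.eq_swap (a := y) (b := o)] at h2
  have hW : ((ω ∩ (↑E : Set (Sym2 V))) \ {s(o, v)}) \ {s(o, y)} ⊆ (ω \ {s(o, y)}) \ {s(o, v)} := by
    rw [Set.sdiff_sdiff_comm]
    exact sdiff_subset_sdiff_left (sdiff_subset_sdiff_left inter_subset_left)
  have hd' : (openGraph ((ω \ {s(o, y)}) \ {s(o, v)})).Reachable v' y' := hd.mono (openGraph_mono hW)
  have hsub : (ω \ {s(o, y)}) \ {s(o, v)} ⊆ ω \ {s(o, v)} := sdiff_subset_sdiff_left sdiff_subset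
  -- (e) `y' ~ y` in `A − f`: the three cases of the pair `e` inside `A − f`
  have hef : s(o, v) ≠ s(o, y) := fun h' => hvy (Sym2.congr_right.1 h')
  have heAf : s(o, v) ∈ ω \ {s(o, y)} := ⟨he, hef⟩
  have hback : insert s(o, v) ((ω \ {s(o, y)}) \ {s(o, v)}) = ω \ {s(o, y)} := by
    rw [insert_sdiff_singleton, insert_eq_of_mem heAf]
  rw [← hback, KNSep.reachable_insert_iff] at hyy
  have hfAe : s(o, y) ∈ ω \ {s(o, v)} := ⟨hf, hef.symm⟩
  rcases hyy with h | ⟨h, -⟩ | ⟨-, h⟩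
  · -- `v ~ v' ~ y' ~ y ~ o` in `A − e`
    exact heA ((hvv.trans ((hd'.trans h).mono (openGraph_mono hsub))).trans (reach_of_mem_sdiff hf hoy hef.symm).symm).symm
  · -- `v ~ v' ~ y' ~ o` in `A − e`
    exact heA ((hvv.trans ((hd'.trans h).mono (openGraph_mono hsub)))).symm
  · -- `o ~ y` in `A − f`
    exact hfA (h.mono (openGraph_mono sdiff_subset))

end PinnedEars

end FK
end Summit.CriticalPhenomena.PercolationContinuityZ3.Theorems

end
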